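import Summits.QuantumFields.BalabanUV.T4Continuum.Support.NE7K1LinBoxCovEnergy
import Summits.QuantumFields.BalabanUV.T4Continuum.Support.NE7K1LinBoxResolventImages

/-!
# NE7K1LinBoxCov237 — row NE7 (node U5), candidate route HOM, path H1L, cell K1-lin(s): NEEDS-ESTIMATE #E1, R-E1 — (o2), PART 2:
# B4 LEMMA 2.4 (2.37) FOR THE TWO-CUTOFF LINE — `|C_s^{(j)}(□; y, y′)| ≤ c·e^{−δ|y−y′|_∞}` for the unit-lattice propagator
# `C_s^{(j)}(□) = (Δ_s^{(j)}(□) + a₂L_P^{−2}P)^{-1}` built from `(T^Π(s) + aQ_n^*Q_n)⁻¹`, EVERY `s ∈ [0,1]`, constants in `(d, ℓ, a±, a₂±)` ONLY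

Lineage `b2b-balaban-t4-ne7-p2` (CRUX PROVER NE7 #2), generation 77; file 81 (= file 80's coercivity + file 77's (2.35) first quantity +
b04's finite Combes–Thomas estimate `B4Sect5Torus.inv_decay`).  PRICING-NE7 v39 §285 (e)(g) (N-40-5 ∕ A-40-1): «(o2) B4 (2.37) IN ITS PRINTED
IDENTITY — the exponential decay of the UNIT-LATTICE propagator `C^{(j)}` of (1.13)–(1.14) built from the two-cutoff line's averaged
resolvent …, constants in (d, a±) only, every s ∈ [0,1]».  Printed (B4 p. 582): «|C^{(j)}(□; y, y′)| ≤ c₀e^{−δ₀|y−y′|} (2.37) for arbitrary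
non-negative integer j, arbitrary, rectangular parallelepiped □ ⊂ L^{−j}Z^d built of large blocks»; b04's hypothesis-free certificate for
`Δ^ξ` is `B4BoxCov237.cov237_box_decay`.  THIS FILE re-runs b04's §6–§7 with the fine operator generalised to the line:

* §1 **`boxLine_blockSum_bound`**: the block–block sums of `G^Π(s) = (T^Π(s) + aQ_n^*Q_n)⁻¹` — the entries of `Q_nG^Π(s)Q_n^*` up to
  `N = n^{d+1}` — decay: `|(indB·G^Π(s)·indBᵀ)(y, y′)| ≤ N·C_□(d,a₋,a₊)·e^{−κ′|y−y′|_∞}` with `C_□ = 2^{d+1}·M_line·periodConst(κ_line)`,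
  `κ′ = κ_line(d+1,a₋,a₊)∕(d+1)` (file 77's `boxResolventKernel_decay'`, row by row); **`KeffS_entry_bound`**:
  `|Δ_s^{(j)}(□)(y, y′)| ≤ (a + a²C_□)·e^{−κ′|y−y′|_∞}`.
* §2 **`cov237S_box_decay`** — (2.37) FOR THE LINE: there are `δ, c > 0`, functions of `(d, ℓ, a₋, a₊, a₂₋, a₂₊)` ALONE, such that for
  EVERY mesh `n ≥ 1`, EVERY `s ∈ [0,1]`, every `a ∈ [a₋,a₊]`, `a₂ ∈ [a₂₋,a₂₊]` and EVERY box `M′` (unit side lengths `L_P·M′`):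
  `Δ_s^{(j)}(□) + a₂L_P^{−2}P` is invertible and `|C_s^{(j)}(□; y, y′)| ≤ c·e^{−δ|y−y′|_∞}` — (k1): no `s`, `n`, `L`, `M′`, level in `(δ, c)`;
  (k2): all `s ∈ [0,1]`; the refinement `L ≥ 1` of the two-cutoff line is arbitrary; **`cov237S_box_form_bounds`** — (1.15) both halves.
  `δ = rate(latticeConst, γ₀, c₀, κ′)` and `c = 2∕γ₀` exactly as in b04 (`γ₀` = file 80's coercivity constant at `a₋, a₂₋`).

HONEST FRAMING: [folklore]; b04's audit route for (2.37) ((1.15) by the Schur-complement energy + block Poincaré; entry decay from (2.35);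
Combes–Thomas) re-run with one operator generalised; A = 0; the Neumann BOX (the printed geometry) — the torus variant and B4 Prop. 2.3's
general `Ω`, `Λ` ((1.16)–(1.20)) are NOT typed here; nothing of Bałaban's asserted; no `sorry`.  Census only ((o2) on boxes); NE7 NOT PRINTED ∕
NOT PROVED; spine 0∕9; FIXED FINITE T⁴, rung (B)+1; NOT infinite volume, NOT mass gap, NOT Clay.  HONEST DEPENDENCY: continuum YM on T⁴ ⇐
BetaPertH ∧ nine spine estimates (0/9 proved); BetaPertH ⇐ (D1) ∧ (D4) ∧ CAP+tail; G-an2-4 gates asym, D1 and NE2/3/4.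
-/

noncomputable section

open Finset Matrix

namespace Summit.QuantumFields.BalabanUV.T4Continuum.NE7K1LinBoxCov237

open Literature.MathematicalPhysics.QuantumFieldTheory.Balaban1983to89
open Literature.MathematicalPhysics.QuantumFieldTheory.Balaban1983to89.B4Reflection242
open Literature.MathematicalPhysics.QuantumFieldTheory.Balaban1983to89.B4Lower18
open Literature.MathematicalPhysics.QuantumFieldTheory.Balaban1983to89.B4ContourShift (supNorm)
open Literature.MathematicalPhysics.QuantumFieldTheory.Balaban1983to89.B4BoxCov237
open Literature.MathematicalPhysics.QuantumFieldTheory.Balaban1983to89.B4TorusKernel (periodConst)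
open Literature.MathematicalPhysics.QuantumFieldTheory.Balaban1983to89.B4Sect5Torus (IsPseudoDist SumBound Hyp56 rate rate_pos
  inv_decay)
open Literature.MathematicalPhysics.QuantumFieldTheory.Balaban1983to89.B4Sect5Proof (latticeConst latticeConst_nonneg latticeSum_le)
open NE7K1LinSchurLineU1 NE7K1LinSchurFoldBox NE7K1LinStripClassLine NE7K1LinStripClassLineDecay
open NE7K1LinBoxResolventImages NE7K1LinBoxCovEnergy

variable {d : ℕ}

/-! ### §1 Entry bounds for `Δ_s^{(j)}(□)` from (2.35) -/

section Entry

variable {n : ℕ} (L : ℕ) [NeZero L] {M : Fin (d + 1) → ℕ}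

/-- the box constant of file 77's (2.35) bound, clipped at `0`: `C_□(d,a₋,a₊) = max(2^{d+1}·M_line(d,a₋)·periodConst(κ_line(d+1,a₋,a₊), d), 0)`.
[folklore] -/
def Cbox (d : ℕ) (aminus aplus : ℝ) : ℝ :=
  max (2 ^ (d + 1) * (Mline d aminus * periodConst (kappaLine (d + 1) aminus aplus) d)) 0

/-- `0 ≤ C_□`. [folklore] -/
theorem Cbox_nonneg (d : ℕ) (aminus aplus : ℝ) : 0 ≤ Cbox d aminus aplus := le_max_right _ _

/-- the entries of the transported inverse are those of the box line's inverse. [folklore] -/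
theorem boxLine_inv_apply (hn : 1 ≤ n) (a s : ℝ) (x x' : ↥(boxDom fun i => n * M i)) :
    (boxLine L hn M a s)⁻¹ x x' =
      (twoCutoffLine (isBlockUnion_fine (fineBox_isBlockUnion hn (NeZero.one_le : 1 ≤ L) M)) n a s)⁻¹
        ((boxEquiv n L M).symm x) ((boxEquiv n L M).symm x') := by
  rw [boxLine, Matrix.inv_reindex]
  simp [Matrix.reindex_apply, Matrix.submatrix_apply]

/-- **ONE BLOCK ROW OF `G^Π(s)` (file 77's (2.35), real form)**: `|Σ_{x′ : blk x′ = y′} G^Π(s)(x, x′)| ≤ C_□·e^{−κ′|blk x − y′|_∞}`. [folklore] -/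
theorem boxLine_blockRow_bound (hn : 1 ≤ n) (hM : ∀ i, 1 ≤ M i) {aminus aplus a : ℝ} (ha : 0 < aminus) (ha1 : aminus ≤ a)
    (ha2 : a ≤ aplus) {s : ℝ} (hs0 : 0 ≤ s) (hs1 : s ≤ 1) (x : ↥(boxDom fun i => n * M i)) (y' : ↥(boxDom M)) :
    |∑ x' ∈ Finset.univ.filter (fun x' : ↥(boxDom fun i => n * M i) => blk n x'.1 = y'.1), (boxLine L hn M a s)⁻¹ x x'|
      ≤ Cbox d aminus aplus * Real.exp (-(kappaLine (d + 1) aminus aplus / (d + 1) * supNorm (blk n x.1 - y'.1))) := by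
  haveI : NeZero n := ⟨by omega⟩
  have hb := boxResolventKernel_decay' hn hM ha ha1 ha2 hs0 hs1 ((boxEquiv n L M).symm x) y'.2
  have hx : ((boxEquiv n L M).symm x).1 = x.1 := rfl
  rw [hx] at hb
  -- the complex sum of file 77 is the cast of the real block-row sum
  have hsum : (∑ z' : ↥((boxDom fun i => n * L * M i).image (blk L)),
      (((twoCutoffLine (isBlockUnion_fine (fineBox_isBlockUnion hn (NeZero.one_le : 1 ≤ L) M)) n a s)⁻¹
          ((boxEquiv n L M).symm x) z' : ℝ) : ℂ) * (if blk n z'.1 = y'.1 then (1 : ℂ) else 0)) =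
      ((∑ x' ∈ Finset.univ.filter (fun x' : ↥(boxDom fun i => n * M i) => blk n x'.1 = y'.1), (boxLine L hn M a s)⁻¹ x x' : ℝ) : ℂ) := by
    rw [Finset.sum_filter, ← Equiv.sum_comp (boxEquiv n L M).symm]
    push_cast
    refine Finset.sum_congr rfl fun x' _ => ?_
    rw [boxLine_inv_apply]
    have hx' : ((boxEquiv n L M).symm x').1 = x'.1 := rfl
    rw [hx']
    split_ifs <;> simp
  rw [hsum, Complex.norm_real, Real.norm_eq_abs] at hb
  refine hb.trans (mul_le_mul_of_nonneg_right (le_max_left _ _) (Real.exp_pos _).le)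

/-- **BLOCK–BLOCK SUMS OF `G^Π(s)` DECAY**: `|(indB·G^Π(s)·indBᵀ)(y, y′)| ≤ N·C_□·e^{−κ′|y−y′|_∞}`, `N = n^{d+1}`. [folklore] -/
theorem boxLine_blockSum_bound (hn : 1 ≤ n) (hM : ∀ i, 1 ≤ M i) {aminus aplus a : ℝ} (ha : 0 < aminus) (ha1 : aminus ≤ a)
    (ha2 : a ≤ aplus) {s : ℝ} (hs0 : 0 ≤ s) (hs1 : s ≤ 1) (y y' : ↥(boxDom M)) :
    |(indB n M * (boxLine L hn M a s)⁻¹ * (indB n M)ᵀ) y y'|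
      ≤ (n : ℝ) ^ (d + 1) * Cbox d aminus aplus * Real.exp (-(kappaLine (d + 1) aminus aplus / (d + 1) * supNorm (y.1 - y'.1))) := by
  rw [indB_mul_mul_transpose_apply]
  have hrow : ∀ x ∈ Finset.univ.filter (fun x : ↥(boxDom fun i => n * M i) => blk n x.1 = y.1),
      |∑ x' ∈ Finset.univ.filter (fun x' : ↥(boxDom fun i => n * M i) => blk n x'.1 = y'.1), (boxLine L hn M a s)⁻¹ x x'|
        ≤ Cbox d aminus aplus * Real.exp (-(kappaLine (d + 1) aminus aplus / (d + 1) * supNorm (y.1 - y'.1))) := by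
    intro x hx
    have hxy : blk n x.1 = y.1 := (Finset.mem_filter.1 hx).2
    have h := boxLine_blockRow_bound L hn hM ha ha1 ha2 hs0 hs1 x y'
    rwa [hxy] at h
  calc |∑ x ∈ Finset.univ.filter (fun x : ↥(boxDom fun i => n * M i) => blk n x.1 = y.1),
          ∑ x' ∈ Finset.univ.filter (fun x' : ↥(boxDom fun i => n * M i) => blk n x'.1 = y'.1), (boxLine L hn M a s)⁻¹ x x'|
      ≤ ∑ x ∈ Finset.univ.filter (fun x : ↥(boxDom fun i => n * M i) => blk n x.1 = y.1),
          |∑ x' ∈ Finset.univ.filter (fun x' : ↥(boxDom fun i => n * M i) => blk n x'.1 = y'.1), (boxLine L hn M a s)⁻¹ x x'| :=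
        Finset.abs_sum_le_sum_abs _ _
    _ ≤ ∑ _x ∈ Finset.univ.filter (fun x : ↥(boxDom fun i => n * M i) => blk n x.1 = y.1),
          Cbox d aminus aplus * Real.exp (-(kappaLine (d + 1) aminus aplus / (d + 1) * supNorm (y.1 - y'.1))) :=
        Finset.sum_le_sum hrow
    _ = (n : ℝ) ^ (d + 1) * Cbox d aminus aplus *
          Real.exp (-(kappaLine (d + 1) aminus aplus / (d + 1) * supNorm (y.1 - y'.1))) := by
        rw [Finset.sum_const, card_filter_blk hn M y, nsmul_eq_mul]
        push_cast
        ring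

/-- **ENTRIES OF `Δ_s^{(j)}(□)` DECAY**: `|Δ_s^{(j)}(□)(y, y′)| ≤ (a + a²C_□)·e^{−κ′|y−y′|_∞}`, every `s ∈ [0,1]`, `a ∈ [a₋,a₊]`, `n`, `L`, box.
[folklore] -/
theorem KeffS_entry_bound (hn : 1 ≤ n) (hM : ∀ i, 1 ≤ M i) {aminus aplus a : ℝ} (ha : 0 < aminus) (ha1 : aminus ≤ a)
    (ha2 : a ≤ aplus) {s : ℝ} (hs0 : 0 ≤ s) (hs1 : s ≤ 1) (y y' : ↥(boxDom M)) :
    |KeffS L hn M a s y y'| ≤ (a + a ^ 2 * Cbox d aminus aplus) *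
      Real.exp (-(kappaLine (d + 1) aminus aplus / (d + 1) * supNorm (y.1 - y'.1))) := by
  set κ := kappaLine (d + 1) aminus aplus / (d + 1) with hκ
  set C := Cbox d aminus aplus with hC
  have ha' : 0 < a := lt_of_lt_of_le ha ha1
  have hn0 : (0 : ℝ) < n := by exact_mod_cast hn
  have hG := boxLine_blockSum_bound L hn hM ha ha1 ha2 hs0 hs1 y y'
  have hE : 0 < Real.exp (-(κ * supNorm (y.1 - y'.1))) := Real.exp_pos _
  have hentry : KeffS L hn M a s y y' = a * (if y = y' then (1 : ℝ) else 0)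
      - a ^ 2 * ((n : ℝ) ^ (d + 1))⁻¹ * (indB n M * (boxLine L hn M a s)⁻¹ * (indB n M)ᵀ) y y' := by
    simp only [KeffS, Matrix.sub_apply, Matrix.smul_apply, Matrix.one_apply, smul_eq_mul]
  have h2 : |a ^ 2 * ((n : ℝ) ^ (d + 1))⁻¹ * (indB n M * (boxLine L hn M a s)⁻¹ * (indB n M)ᵀ) y y'|
      ≤ a ^ 2 * C * Real.exp (-(κ * supNorm (y.1 - y'.1))) := by
    rw [abs_mul, abs_of_nonneg (by positivity : (0 : ℝ) ≤ a ^ 2 * ((n : ℝ) ^ (d + 1))⁻¹)]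
    have hN : (n : ℝ) ^ (d + 1) ≠ 0 := by positivity
    calc a ^ 2 * ((n : ℝ) ^ (d + 1))⁻¹ * |(indB n M * (boxLine L hn M a s)⁻¹ * (indB n M)ᵀ) y y'|
        ≤ a ^ 2 * ((n : ℝ) ^ (d + 1))⁻¹ * ((n : ℝ) ^ (d + 1) * C * Real.exp (-(κ * supNorm (y.1 - y'.1)))) :=
          mul_le_mul_of_nonneg_left hG (by positivity)
      _ = a ^ 2 * C * Real.exp (-(κ * supNorm (y.1 - y'.1))) := by field_simp
  have h1 : |a * (if y = y' then (1 : ℝ) else 0)| ≤ a * Real.exp (-(κ * supNorm (y.1 - y'.1))) := by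
    by_cases hyy : y = y'
    · subst hyy
      rw [if_pos rfl, mul_one, abs_of_pos ha', sub_self, supNorm_zero', mul_zero, neg_zero, Real.exp_zero, mul_one]
    · rw [if_neg hyy, mul_zero, abs_zero]
      positivity
  rw [hentry]
  calc |a * (if y = y' then (1 : ℝ) else 0)
        - a ^ 2 * ((n : ℝ) ^ (d + 1))⁻¹ * (indB n M * (boxLine L hn M a s)⁻¹ * (indB n M)ᵀ) y y'|
      ≤ |a * (if y = y' then (1 : ℝ) else 0)|
        + |a ^ 2 * ((n : ℝ) ^ (d + 1))⁻¹ * (indB n M * (boxLine L hn M a s)⁻¹ * (indB n M)ᵀ) y y'| := abs_sub _ _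
    _ ≤ a * Real.exp (-(κ * supNorm (y.1 - y'.1))) + a ^ 2 * C * Real.exp (-(κ * supNorm (y.1 - y'.1))) := add_le_add h1 h2
    _ = (a + a ^ 2 * C) * Real.exp (-(κ * supNorm (y.1 - y'.1))) := by ring

end Entry

/-! ### §2 (2.37) for the line: exponential decay of `C_s^{(j)}(□)` by the finite Combes–Thomas estimate -/

section Decay

variable (L : ℕ) [NeZero L]

/-- **B4 LEMMA 2.4, THIRD QUANTITY (2.37), FOR THE TWO-CUTOFF LINE ON A NEUMANN BOX — `|C_s^{(j)}(□; y, y′)| ≤ c·e^{−δ|y−y′|_∞}`.**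
For every dimension `d + 1`, next-step block `L_P = ℓ + 1 ≥ 2`, window `a ∈ [a₋,a₊]` (`a₋ > 0`), `a₂ ∈ [a₂₋,a₂₊]` (`a₂₋ > 0`) and refinement
`L ≥ 1` there are `δ, c > 0` — functions of `(d, ℓ, a₋, a₊, a₂₋, a₂₊)` ALONE — such that for EVERY mesh `n ≥ 1`, EVERY `s ∈ [0,1]` and EVERY
box `M′`: `Δ_s^{(j)}(□) + a₂L_P^{−2}P` is invertible and `|(Δ_s^{(j)}(□) + a₂L_P^{−2}P)⁻¹(y, y′)| ≤ c·e^{−δ|y − y′|_∞}` for all unit sites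
`y, y′` — b04's `cov237_box_decay` with the NN fine operator replaced by the line. [folklore] -/
theorem cov237S_box_decay (d ℓ : ℕ) (hℓ : 1 ≤ ℓ) (aminus aplus a2minus a2plus : ℝ) (ha : 0 < aminus) (ha2 : 0 < a2minus)
    (L : ℕ) [NeZero L] :
    ∃ δ c : ℝ, 0 < δ ∧ 0 < c ∧ ∀ (n : ℕ) (hn : 1 ≤ n) (a a₂ s : ℝ), aminus ≤ a → a ≤ aplus → a2minus ≤ a₂ → a₂ ≤ a2plus →
      0 ≤ s → s ≤ 1 → ∀ (M' : Fin (d + 1) → ℕ), (∀ i, 1 ≤ M' i) →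
        covOpS L hn ℓ M' a a₂ s * (covOpS L hn ℓ M' a a₂ s)⁻¹ = 1 ∧
        ∀ y y' : ↥(boxDom fun i => (ℓ + 1) * M' i),
          |(covOpS L hn ℓ M' a a₂ s)⁻¹ y y'| ≤ c * Real.exp (-(δ * supNorm (y.1 - y'.1))) := by
  set κ : ℝ := kappaLine (d + 1) aminus aplus / (d + 1) with hκdef
  set C : ℝ := Cbox d aminus aplus with hCdef
  have hκ : 0 < κ := div_pos (kappaLine_pos (d + 1) aplus ha) (by positivity)
  have hC : 0 ≤ C := Cbox_nonneg d aminus aplus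
  set γ₀ : ℝ := min (min (aminus / (8 * (d + 1))) (1 / 8) / ((ℓ : ℝ) * (ℓ + 1) / 2)) (a2minus / ((ℓ : ℝ) + 1) ^ 2) with hγ₀
  set c₀ : ℝ := |aplus| + aplus ^ 2 * C + |a2plus| * Real.exp (κ * ℓ) with hc₀
  have hℓ1 : (1 : ℝ) ≤ ℓ := by exact_mod_cast hℓ
  have hP : (0 : ℝ) < (ℓ : ℝ) * (ℓ + 1) / 2 := by positivity
  have hγ : 0 < γ₀ := lt_min (by positivity) (by positivity)
  have hc : 0 ≤ c₀ := by positivity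
  have hKn : ∀ t : ℝ, 0 < t → 0 ≤ latticeConst (d + 1) t := fun t ht => latticeConst_nonneg (d + 1) ht.le
  refine ⟨rate (latticeConst (d + 1)) γ₀ c₀ κ, 2 / γ₀, rate_pos hKn hγ hc hκ, by positivity, ?_⟩
  intro n hn a a₂ s h1 h2 h5 h6 hs0 hs1 M' hM
  have ha₁ : 0 < a := lt_of_lt_of_le ha h1
  have ha₂ : 0 ≤ a₂ := le_trans ha2.le h5
  have hMℓ : ∀ i, 1 ≤ (ℓ + 1) * M' i := fun i => by nlinarith [hM i]
  have hA : Hyp56 (rho fun i => (ℓ + 1) * M' i) (covOpS L hn ℓ M' a a₂ s) γ₀ c₀ κ := by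
    refine ⟨covOpS_isSymm L hn ℓ M' a a₂ s, fun v => ?_, fun p q => ?_⟩
    · have hge := covOpS_form_ge L hn hℓ ha₁ ha₂ hs0 hs1 hM v
      have hγle : γ₀ ≤ min (min (a / (8 * (d + 1))) (1 / 8) / ((ℓ : ℝ) * (ℓ + 1) / 2)) (a₂ / ((ℓ : ℝ) + 1) ^ 2) := by
        apply min_le_min
        · apply div_le_div_of_nonneg_right _ hP.le
          exact min_le_min (div_le_div_of_nonneg_right h1 (by positivity)) le_rfl
        · exact div_le_div_of_nonneg_right h5 (by positivity)
      have hvv : ∑ p, v p ^ 2 = v ⬝ᵥ v := by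
        unfold dotProduct
        exact Finset.sum_congr rfl fun p _ => by ring
      have hvv0 : 0 ≤ v ⬝ᵥ v := by
        rw [← hvv]
        exact Finset.sum_nonneg fun _ _ => sq_nonneg _
      rw [hvv]
      show γ₀ * (v ⬝ᵥ v) ≤ v ⬝ᵥ (covOpS L hn ℓ M' a a₂ s).mulVec v
      exact (mul_le_mul_of_nonneg_right hγle hvv0).trans hge
    · unfold rho
      have hKe := KeffS_entry_bound L hn hMℓ ha h1 h2 hs0 hs1 (M := fun i => (ℓ + 1) * M' i) p q
      have hPe := blockAvgP_entry_bound ℓ M' hκ.le p q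
      have hE := Real.exp_pos (-(κ * supNorm (p.1 - q.1)))
      have hL2 : a₂ / ((ℓ : ℝ) + 1) ^ 2 ≤ |a2plus| :=
        calc a₂ / ((ℓ : ℝ) + 1) ^ 2 ≤ a₂ := div_le_self ha₂ (one_le_pow₀ (by linarith))
          _ ≤ a2plus := h6
          _ ≤ |a2plus| := le_abs_self _
      have hK2 : a + a ^ 2 * C ≤ |aplus| + aplus ^ 2 * C := by
        have hsq : a ^ 2 ≤ aplus ^ 2 := pow_le_pow_left₀ ha₁.le h2 2
        have habs : a ≤ |aplus| := h2.trans (le_abs_self _)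
        nlinarith
      have hentry : covOpS L hn ℓ M' a a₂ s p q
          = KeffS L hn (fun i => (ℓ + 1) * M' i) a s p q + a₂ / ((ℓ : ℝ) + 1) ^ 2 * blockAvgP ℓ M' p q := by
        simp only [covOpS, Matrix.add_apply, Matrix.smul_apply, smul_eq_mul]
      rw [hentry]
      calc |KeffS L hn (fun i => (ℓ + 1) * M' i) a s p q + a₂ / ((ℓ : ℝ) + 1) ^ 2 * blockAvgP ℓ M' p q|
          ≤ |KeffS L hn (fun i => (ℓ + 1) * M' i) a s p q| + |a₂ / ((ℓ : ℝ) + 1) ^ 2 * blockAvgP ℓ M' p q| :=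
            abs_add_le _ _
        _ ≤ (a + a ^ 2 * C) * Real.exp (-(κ * supNorm (p.1 - q.1)))
            + a₂ / ((ℓ : ℝ) + 1) ^ 2 * (Real.exp (κ * ℓ) * Real.exp (-(κ * supNorm (p.1 - q.1)))) := by
            refine add_le_add hKe ?_
            rw [abs_mul, abs_of_nonneg (by positivity : (0 : ℝ) ≤ a₂ / ((ℓ : ℝ) + 1) ^ 2)]
            exact mul_le_mul_of_nonneg_left hPe (by positivity)
        _ ≤ (|aplus| + aplus ^ 2 * C) * Real.exp (-(κ * supNorm (p.1 - q.1)))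
            + |a2plus| * (Real.exp (κ * ℓ) * Real.exp (-(κ * supNorm (p.1 - q.1)))) :=
            add_le_add (mul_le_mul_of_nonneg_right hK2 hE.le) (mul_le_mul_of_nonneg_right hL2 (by positivity))
        _ = c₀ * Real.exp (-(κ * supNorm (p.1 - q.1))) := by
            rw [hc₀]
            ring
  exact ⟨covOpS_mul_inv L hn hℓ ha₁ (lt_of_lt_of_le ha2 h5) hs0 hs1 hM,
    fun y y' => inv_decay hKn hγ hc hκ (rho_isPseudoDist _) (rho_sumBound _) hA y y'⟩

/-- **B4 PROPOSITION 2.3 (1.15) FOR THE LINE ON THE BOX, `Λ = □^{(j)}` — `γ₀‖ω‖² ≤ ⟨ω, (Δ_s^{(j)}(□) + a₂L_P^{−2}P)ω⟩ ≤ γ₁‖ω‖²`** with `γ₀, γ₁`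
functions of `(d, ℓ, a±, a₂±)` only, for EVERY `n ≥ 1`, `s ∈ [0,1]`, `L ≥ 1` and box. [folklore] -/
theorem cov237S_box_form_bounds (d ℓ : ℕ) (hℓ : 1 ≤ ℓ) (aminus aplus a2minus a2plus : ℝ) (ha : 0 < aminus) (ha2 : 0 < a2minus)
    (L : ℕ) [NeZero L] :
    ∃ γ₀ γ₁ : ℝ, 0 < γ₀ ∧ γ₀ ≤ γ₁ ∧ ∀ (n : ℕ) (hn : 1 ≤ n) (a a₂ s : ℝ), aminus ≤ a → a ≤ aplus → a2minus ≤ a₂ → a₂ ≤ a2plus →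
      0 ≤ s → s ≤ 1 → ∀ (M' : Fin (d + 1) → ℕ), (∀ i, 1 ≤ M' i) → ∀ ω : ↥(boxDom fun i => (ℓ + 1) * M' i) → ℝ,
        γ₀ * (ω ⬝ᵥ ω) ≤ ω ⬝ᵥ (covOpS L hn ℓ M' a a₂ s).mulVec ω ∧ ω ⬝ᵥ (covOpS L hn ℓ M' a a₂ s).mulVec ω ≤ γ₁ * (ω ⬝ᵥ ω) := by
  set γ₀ : ℝ := min (min (aminus / (8 * (d + 1))) (1 / 8) / ((ℓ : ℝ) * (ℓ + 1) / 2)) (a2minus / ((ℓ : ℝ) + 1) ^ 2) with hγ₀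
  have hℓ1 : (1 : ℝ) ≤ ℓ := by exact_mod_cast hℓ
  have hP : (0 : ℝ) < (ℓ : ℝ) * (ℓ + 1) / 2 := by positivity
  have hγ : 0 < γ₀ := lt_min (by positivity) (by positivity)
  refine ⟨γ₀, max γ₀ (|aplus| + |a2plus|), hγ, le_max_left _ _, ?_⟩
  intro n hn a a₂ s h1 h2 h5 h6 hs0 hs1 M' hM ω
  have ha₁ : 0 < a := lt_of_lt_of_le ha h1
  have ha₂ : 0 ≤ a₂ := le_trans ha2.le h5
  have hvv0 : 0 ≤ ω ⬝ᵥ ω := by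
    unfold dotProduct
    exact Finset.sum_nonneg fun _ _ => mul_self_nonneg _
  constructor
  · have hge := covOpS_form_ge L hn hℓ ha₁ ha₂ hs0 hs1 hM ω
    have hγle : γ₀ ≤ min (min (a / (8 * (d + 1))) (1 / 8) / ((ℓ : ℝ) * (ℓ + 1) / 2)) (a₂ / ((ℓ : ℝ) + 1) ^ 2) := by
      apply min_le_min
      · apply div_le_div_of_nonneg_right _ hP.le
        exact min_le_min (div_le_div_of_nonneg_right h1 (by positivity)) le_rfl
      · exact div_le_div_of_nonneg_right h5 (by positivity)
    exact (mul_le_mul_of_nonneg_right hγle hvv0).trans hge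
  · have hle := covOpS_form_le L hn ha₁ ha₂ hs0 hs1 hM ω (ℓ := ℓ)
    have hL2 : a + a₂ / ((ℓ : ℝ) + 1) ^ 2 ≤ max γ₀ (|aplus| + |a2plus|) := by
      refine le_trans ?_ (le_max_right _ _)
      have : a₂ / ((ℓ : ℝ) + 1) ^ 2 ≤ a₂ := div_le_self ha₂ (one_le_pow₀ (by linarith))
      have := le_abs_self aplus
      have := le_abs_self a2plus
      linarith
    exact hle.trans (mul_le_mul_of_nonneg_right hL2 hvv0)

/-- non-vacuity at the physical dimension `d + 1 = 4`, next-step block `L_P = 2`, refinement `L = 3`, window `a, a₂ ∈ [1∕2, 2]`: the constants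
exist and the bound is a genuine statement about every box, every mesh and every `s ∈ [0,1]`. -/
example : ∃ δ c : ℝ, 0 < δ ∧ 0 < c ∧ ∀ (n : ℕ) (hn : 1 ≤ n) (a a₂ s : ℝ), (1 / 2 : ℝ) ≤ a → a ≤ 2 → (1 / 2 : ℝ) ≤ a₂ → a₂ ≤ 2 →
    0 ≤ s → s ≤ 1 → ∀ (M' : Fin (3 + 1) → ℕ), (∀ i, 1 ≤ M' i) →
      covOpS 3 hn 1 M' a a₂ s * (covOpS 3 hn 1 M' a a₂ s)⁻¹ = 1 ∧
      ∀ y y' : ↥(boxDom fun i => (1 + 1) * M' i),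
        |(covOpS 3 hn 1 M' a a₂ s)⁻¹ y y'| ≤ c * Real.exp (-(δ * supNorm (y.1 - y'.1))) :=
  cov237S_box_decay 3 1 le_rfl (1 / 2) 2 (1 / 2) 2 (by norm_num) (by norm_num) 3

end Decay

end Summit.QuantumFields.BalabanUV.T4Continuum.NE7K1LinBoxCov237

end
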